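import Summits.QuantumFields.YangMills.Theorems.VirialFluxGapAnchorSliceRotations
import HarnessLib

/-!
# The TWO-ANCHOR SLICE IS HIT: every configuration whose anchors are `O(1)`-close to `(C₀, ±N₀)` is conjugate, by an EXPLICIT constant
# `k ∈ SU(2)`, to a point of the anchor slice — the covering ∕ `hfloor` input of the DIRECT Laplace road to ⟨stmt-QuantumFields-24204⟩
# `VirialFluxGap.SharpTwistedLaplace` (layer (B2), item (c) «LEFT FOR OTHERS» of width seat w3 g57's anchor programme)

Helper module (free-hands work of width seat ym-line-sfw-p2-w2 g50, cell ym-idea-1; `--supports 24204`), in the letters of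
✓`VirialFluxGapAnchorSliceAlgebra` ∕ ✓`VirialFluxGapAnchorChartDefs` (w3 g57): `n_C = ιω_C` (seam anchor `C₀`), `n_N = ιω_N ⊥ n_C` (link anchor
`N₀ = ±n_N`), slices `seamSlice t = e^{ι(tω_C)}·C₀` and `linkSlice b = e^{ιb}·N₀` (`b ⊥ ω_C`).  The residual `SU(2)` acts by conjugation.

THE CONSTRUCTION (pure quaternion algebra, no inverse function theorem, no intermediate-value argument).
* §1 AXIS ALIGNMENT.  For pure units `m, n` with `‖m − n‖ < 1` the unit `κ₁ = ρ/‖ρ‖`, `ρ = 1 − n m`, satisfies `κ₁ m κ₁* = n`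
  (`ρ m = m + n = n ρ`) and `‖κ₁ − 1‖ ≤ 2‖m − n‖` (`conj_alignAxis`).  Applied to the axis `m = Im u_C/‖Im u_C‖` of the seam anchor `u_C` it puts
  `κ₁ u_C κ₁*` EXACTLY on the seam slice: `= Re u_C + ‖Im u_C‖·n_C = e^{ι(tω_C)} n_C` with `sin t = −Re u_C` (`conj_seam_normalForm`).
* §2 AZIMUTH.  For a unit `w` with `Re w > 0` write `w = w₀ + w_n n_C + w_⊥` (`w_⊥ ⊥ n_C`); the unit `g = (w₀ − w_n n_C)/√(w₀² + w_n²) ∈ T_{n_C}`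
  has the half-angle square root `κ₂ = (1 + g)/‖1 + g‖ ∈ T_{n_C}` (`κ₂² = g`), and since `n_C` anticommutes with `w_⊥`,
  `κ₂ w κ₂ = (w₀ + w_n n_C)·g + w_⊥ = √(w₀² + w_n²) + w_⊥` — the `n_C`-component is killed EXACTLY (`conj_azimuth_normalForm`); `κ₂` commutes
  with the seam slice, and `N₀ κ₂* N₀⁻¹ = κ₂`, so on the link anchor `κ₂ (w N₀) κ₂* = (κ₂ w κ₂) N₀`.
* §3 ★★ `exists_conj_anchor_slice` — for unit quaternions `u_C, u_N` with `‖u_C − n_C‖ ≤ δ`, `‖u_N − N₀‖ ≤ δ`, `δ ≤ 1/20`: a unit `κ` with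
  `‖κ − 1‖ ≤ 30δ`, a real `t` with `|t| < π/2`, `|sin t| ≤ δ`, and `b ∈ ℝ³` with `⟪b, ω_C⟫ = 0`, `‖b‖ ≤ 20δ`, such that
  `κ u_C κ* = e^{ι(tω_C)}·n_C` and `κ u_N κ* = e^{ιb}·N₀`; ★★ `exists_conj_anchor_slice_su2` — the same in `SU(2)` with `expPoint`.
  Every OTHER coordinate `u_i` of the configuration is then read in its own left chart, `κ u_i κ* = e^{ι a_i} q_i` with
  `a_i = logVec(κ u_i κ* q_i⁻¹)` (✓`expPoint_logVec`) and `‖κ u_i κ* − q_i‖ ≤ ‖u_i − q_i‖ + 2‖κ − 1‖` (`norm_conj_sub_le`).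
So the tubes `SU(2)·σ(window)` of the anchor slice contain every point of `X_fix` whose coordinates are uniformly close to `Q_s` — with
✓`ringDeficit_fix_floor` this is the hypothesis `hfloor` of ✓`sharpTwistedLaplace_of_fixTubes` (assembly: item (d)).
Everything here is PROVED; no definitions, no named facts (namespace `Summit.QuantumFields.YangMills.Theorems.VirialFluxGap.AnchorSlice`).

HONEST FRAMING: quaternion algebra; ⟨24204⟩, ⟨24319⟩, ⟨22884⟩ and every rung stay OPEN; the Yang–Mills mass gap (Clay) is NOT touched; no summit is
proved by a line.

## References
* G. E. Bredon, *Introduction to Compact Transformation Groups* (1972), Ch. II §§4–5 (tubes `K ×_S B` are neighbourhoods of the orbit). [Bredon1972]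
* A. González-Arroyo, C. P. Korthals Altes, Nucl. Phys. B311 (1988), §2. [GonzalezarroyoAltes1988]
-/

set_option autoImplicit false

noncomputable section

open scoped Quaternion RealInnerProductSpace
open NormedSpace
open Literature.MathematicalPhysics.QuantumFieldTheory hiding SU2
open Literature.MathematicalPhysics.QuantumLattice
open Literature.MathematicalPhysics.QuantumFieldTheory.Balaban1983to89.T4WilsonGaugeFlatDirection (su2Quat_injective)
open Literature.MathematicalPhysics.QuantumFieldTheory.Balaban1983to89.T4WilsonLinkAffine (su2Quat_inv)
open Literature.MathematicalPhysics.QuantumFieldTheory.Balaban1983to89.T4HaarSU2ExpChart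
open Literature.MathematicalPhysics.QuantumFieldTheory.Balaban1983to89.T4ExpWindowSmallField
open Literature.MathematicalPhysics.QuantumFieldTheory.Balaban1983to89.T4HaarSU2Translate (su2Quat_quatToSU2)
open Summit.QuantumFields.YangMills.Theorems.FemtoTransferGap
open Summit.QuantumFields.YangMills.Theorems.FemtoTransferGap.TT
open Summit.QuantumFields.YangMills.Theorems.FibreLocalInverse (star_mul_self_of_norm_eq_one self_mul_star_of_norm_eq_one)
open Summit.QuantumFields.BalabanUV.InfraRed.StrongCouplingSphereCalculus (mul_self_of_re_eq_zero)
open Literature.MathematicalPhysics.QuantumFieldTheory.Federbush1986.SU2 (norm_im_le)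
open Summit.QuantumFields.YangMills.Theorems.QuantitativeLaplace (quat_norm_im_eq_sqrt)

namespace Summit.QuantumFields.YangMills.Theorems.VirialFluxGap.AnchorSlice

/-! ## §3 The two-anchor covering theorem -/

/-- `⟪imVec q, ω⟫_{ℝ³} = ⟪q, ιω⟫_ℍ`. [folklore] -/
theorem inner_imVec_eq_inner_imQuat (q : ℍ) (ω : EuclideanSpace ℝ (Fin 3)) : ⟪imVec q, ω⟫ = ⟪q, imQuat ω⟫ := by
  rw [Quaternion.inner_def, PiLp.inner_apply, Fin.sum_univ_three]
  simp [imQuat_apply]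
  ring

/-- `⟪ιx, ιy⟫_ℍ = ⟪x, y⟫_{ℝ³}`. [folklore] -/
theorem inner_imQuat_imQuat (x y : EuclideanSpace ℝ (Fin 3)) : ⟪imQuat x, imQuat y⟫ = ⟪x, y⟫ := by
  rw [← inner_imVec_eq_inner_imQuat]
  congr 1
  ext i; fin_cases i <;> simp [imVec, imQuat_apply]

/-- The logarithm vector of a quaternion with no `n`-component and real part `> −1`... precisely: if `⟪q, ιω⟫ = 0` then `⟪logVec q, ω⟫ = 0`
provided `q` is not the south pole (`Re q ≠ −1` is not even needed: at the poles `logVec` points along `e₀` with length `arccos(Re q)`,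
so we assume `Re q = 1` there, i.e. we require `imVec q = 0 → q.re = 1`). [folklore] -/
theorem inner_logVec_eq_zero {q : ℍ} {ω : EuclideanSpace ℝ (Fin 3)} (hq : ⟪q, imQuat ω⟫ = 0) (hpole : imVec q = 0 → q.re = 1) :
    ⟪logVec q, ω⟫ = 0 := by
  unfold logVec
  split_ifs with h
  · rw [hpole h, Real.arccos_one, zero_smul, inner_zero_left]
  · rw [real_inner_smul_left, inner_imVec_eq_inner_imQuat, hq, mul_zero]

/-- For a unit `w`: `arccos(Re w) ≤ (π/2)·‖w − 1‖` (Jordan's inequality on the half angle). [folklore] -/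
theorem arccos_re_le_of_unit {w : ℍ} (hw : ‖w‖ = 1) : Real.arccos w.re ≤ Real.pi / 2 * ‖w - 1‖ := by
  rw [norm_sub_one_eq_two_mul_sin hw]
  set θ := Real.arccos w.re with hθ
  have h0 : 0 ≤ θ := Real.arccos_nonneg _
  have hπ : θ ≤ Real.pi := Real.arccos_le_pi _
  have hj : 2 / Real.pi * (θ / 2) ≤ Real.sin (θ / 2) := Real.mul_le_sin (by linarith) (by linarith)
  have hpi : 0 < Real.pi := Real.pi_pos
  have : θ ≤ Real.pi * Real.sin (θ / 2) := by
    have := mul_le_mul_of_nonneg_left hj hpi.le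
    calc θ = Real.pi * (2 / Real.pi * (θ / 2)) := by field_simp
      _ ≤ Real.pi * Real.sin (θ / 2) := this
  linarith

/-- A pure quaternion orthogonal to `n_C`, `n_N` and `n_C n_N` (for orthogonal pure units `n_C, n_N`) vanishes. [folklore] -/
theorem eq_zero_of_orth_anchor_frame {r nC nN : ℍ} (hr : r.re = 0) (hC0 : nC.re = 0) (hC1 : ‖nC‖ = 1) (hN0 : nN.re = 0) (hN1 : ‖nN‖ = 1)
    (hCN : ⟪nC, nN⟫ = 0) (h1 : ⟪r, nC⟫ = 0) (h2 : ⟪r, nN⟫ = 0) (h3 : ⟪r, nC * nN⟫ = 0) : r = 0 := by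
  have hX0 : (nC * nN).re = 0 := by rw [re_pure_mul_pure hC0 hN0, hCN, neg_zero]
  have a1 : nC * r = -(r * nC) := mul_eq_neg_mul_of_pure_orth hr hC0 h1
  have a2 : nN * r = -(r * nN) := mul_eq_neg_mul_of_pure_orth hr hN0 h2
  have a3 : nC * nN * r = -(r * (nC * nN)) := mul_eq_neg_mul_of_pure_orth hr hX0 h3
  have a4 : nC * nN * r = r * (nC * nN) := by
    rw [mul_assoc, a2, mul_neg, ← mul_assoc, a1, neg_mul, neg_neg, mul_assoc]
  have h0 : r * (nC * nN) = 0 := by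
    have : (2 : ℝ) • (r * (nC * nN)) = 0 := by rw [two_smul]; nth_rewrite 1 [← a4]; rw [a3, neg_add_cancel]
    simpa using this
  have hunit : (nC * nN) * star (nC * nN) = 1 := self_mul_star_of_norm_eq_one (by rw [norm_mul, hC1, hN1, mul_one])
  calc r = r * ((nC * nN) * star (nC * nN)) := by rw [hunit, mul_one]
    _ = 0 := by rw [← mul_assoc, h0, zero_mul]

/-- Expansion in the anchor frame: a vector `b ⊥ ω_C` is `⟪b, ω_N⟫ω_N + ⟪b, ω_×⟫ω_×` (`ιω_× = ιω_C ιω_N`). [folklore] -/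
theorem eq_smul_add_smul_of_inner_eq_zero {ωC ωN ωX : EuclideanSpace ℝ (Fin 3)} (hC : ‖ωC‖ = 1) (hN : ‖ωN‖ = 1) (hCN : ⟪ωC, ωN⟫ = 0)
    (hX : imQuat ωX = imQuat ωC * imQuat ωN) {b : EuclideanSpace ℝ (Fin 3)} (hb : ⟪b, ωC⟫ = 0) :
    b = ⟪b, ωN⟫ • ωN + ⟪b, ωX⟫ • ωX := by
  have hC0 : (imQuat ωC).re = 0 := imQuat_re ωC
  have hN0 : (imQuat ωN).re = 0 := imQuat_re ωN
  have hC1 : ‖imQuat ωC‖ = 1 := by rw [norm_imQuat, hC]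
  have hN1 : ‖imQuat ωN‖ = 1 := by rw [norm_imQuat, hN]
  have hCN' : ⟪imQuat ωC, imQuat ωN⟫ = 0 := by rw [inner_imQuat_imQuat, hCN]
  have hX1 : ‖ωX‖ = 1 := by rw [← norm_imQuat, hX, norm_mul, hC1, hN1, mul_one]
  have hNX : ⟪ωN, ωX⟫ = 0 := by
    rw [← inner_imQuat_imQuat, hX, real_inner_comm]; exact inner_pure_mul_right hC0 hN0
  have hCX : ⟪ωC, ωX⟫ = 0 := by
    rw [← inner_imQuat_imQuat, hX, real_inner_comm]; exact inner_pure_mul_left hC0 hN0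
  have hNN : ⟪ωN, ωN⟫ = 1 := by rw [real_inner_self_eq_norm_sq, hN, one_pow]
  have hXX : ⟪ωX, ωX⟫ = 1 := by rw [real_inner_self_eq_norm_sq, hX1, one_pow]
  set r : EuclideanSpace ℝ (Fin 3) := b - ⟪b, ωN⟫ • ωN - ⟪b, ωX⟫ • ωX with hr
  have r1 : ⟪r, ωC⟫ = 0 := by
    rw [hr, inner_sub_left, inner_sub_left, real_inner_smul_left, real_inner_smul_left, hb, real_inner_comm ωC ωN, hCN,
      real_inner_comm ωC ωX, hCX]; ring
  have r2 : ⟪r, ωN⟫ = 0 := by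
    rw [hr, inner_sub_left, inner_sub_left, real_inner_smul_left, real_inner_smul_left, hNN, real_inner_comm ωN ωX, hNX]; ring
  have r3 : ⟪r, ωX⟫ = 0 := by
    rw [hr, inner_sub_left, inner_sub_left, real_inner_smul_left, real_inner_smul_left, hNX, hXX]; ring
  have hr0 : imQuat r = 0 :=
    eq_zero_of_orth_anchor_frame (imQuat_re r) hC0 hC1 hN0 hN1 hCN' (by rw [inner_imQuat_imQuat, r1])
      (by rw [inner_imQuat_imQuat, r2]) (by rw [← hX, inner_imQuat_imQuat, r3])
  have : r = 0 := imQuat_injective (by rw [hr0, map_zero])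
  rw [hr] at this
  have e : b = (b - ⟪b, ωN⟫ • ωN - ⟪b, ωX⟫ • ωX) + (⟪b, ωN⟫ • ωN + ⟪b, ωX⟫ • ωX) := by abel
  rw [this, zero_add] at e
  exact e


/-- ★★ **THE TWO-ANCHOR COVERING THEOREM (quaternions).**  `ω_C ⊥ ω_N` unit vectors, `N₀ = ±ιω_N`; `u_C, u_N` unit quaternions with
`‖u_C − ιω_C‖ ≤ δ`, `‖u_N − N₀‖ ≤ δ`, `δ ≤ 1/40`.  Then there are a unit `κ` with `‖κ − 1‖ ≤ 40δ`, a real `t` with `|t| < π/2`, `|sin t| ≤ δ`,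
and `b ⊥ ω_C` with `‖b‖ ≤ 15δ` such that `κ u_C κ* = e^{ι(tω_C)}·ιω_C` (seam slice) and `κ u_N κ* = e^{ιb}·N₀` (link slice) — EXACTLY.
[cite: Bredon1972, Ch. II §§4–5] -/
theorem exists_conj_anchor_slice {ωC ωN : EuclideanSpace ℝ (Fin 3)} (hC : ‖ωC‖ = 1) (hN : ‖ωN‖ = 1) (hCN : ⟪ωC, ωN⟫ = 0)
    {N₀ : ℍ} (hN₀ : N₀ = imQuat ωN ∨ N₀ = -imQuat ωN) {uC uN : ℍ} (huC : ‖uC‖ = 1) (huN : ‖uN‖ = 1)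
    {δ : ℝ} (hδ : δ ≤ 1 / 40) (h1 : ‖uC - imQuat ωC‖ ≤ δ) (h2 : ‖uN - N₀‖ ≤ δ) :
    ∃ (κ : ℍ) (t : ℝ) (b : EuclideanSpace ℝ (Fin 3)), ‖κ‖ = 1 ∧ ‖κ - 1‖ ≤ 40 * δ ∧ |t| < Real.pi / 2 ∧ |Real.sin t| ≤ δ ∧
      ⟪b, ωC⟫ = 0 ∧ ‖b‖ ≤ 15 * δ ∧
      κ * uC * star κ = exp (imQuat (t • ωC)) * imQuat ωC ∧ κ * uN * star κ = exp (imQuat b) * N₀ := by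
  set nC : ℍ := imQuat ωC with hnC
  set nN : ℍ := imQuat ωN with hnN
  have hC0 : nC.re = 0 := imQuat_re ωC
  have hN0 : nN.re = 0 := imQuat_re ωN
  have hC1 : ‖nC‖ = 1 := by rw [hnC, norm_imQuat, hC]
  have hN1 : ‖nN‖ = 1 := by rw [hnN, norm_imQuat, hN]
  have hCN' : ⟪nC, nN⟫ = 0 := by rw [hnC, hnN, inner_imQuat_imQuat, hCN]
  have hNC : nN * nC = -(nC * nN) := mul_eq_neg_mul_of_pure_orth hC0 hN0 hCN'
  have hNN : nN * nN = -1 := mul_self_of_re_eq_zero hN0 hN1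
  have hδ0 : 0 ≤ δ := (norm_nonneg _).trans h1
  -- `N₀` is a pure unit; conjugation by `N₀` is conjugation by `n_N`
  have hN₀1 : ‖N₀‖ = 1 := by
    rcases hN₀ with h | h
    · rw [h]; exact hN1
    · rw [h, norm_neg]; exact hN1
  have hN₀conj : ∀ x : ℍ, N₀ * x * star N₀ = nN * x * star nN := by
    intro x
    rcases hN₀ with h | h
    · rw [h]
    · rw [h, star_neg, neg_mul, mul_neg, neg_mul, neg_neg]
  have hN₀N₀ : star N₀ * N₀ = 1 := star_mul_self_of_norm_eq_one hN₀1
  -- Step 1: the seam anchor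
  obtain ⟨κ₁, t, hκ₁1, hseam, htπ, hsin, hre, hκ₁d⟩ := conj_seam_normalForm hC huC (hδ.trans (by norm_num)) h1
  -- the link anchor after step 1
  obtain ⟨v, hv⟩ : ∃ v : ℍ, v = κ₁ * uN * star κ₁ := ⟨_, rfl⟩
  have hv1 : ‖v‖ = 1 := by rw [hv, norm_mul, norm_mul, norm_star, hκ₁1, huN]; norm_num
  obtain ⟨w, hw⟩ : ∃ w : ℍ, w = v * star N₀ := ⟨_, rfl⟩
  have hw1 : ‖w‖ = 1 := by rw [hw, norm_mul, norm_star, hv1, hN₀1, mul_one]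
  have hwv : w * N₀ = v := by rw [hw, mul_assoc, hN₀N₀, mul_one]
  have hwd : ‖w - 1‖ ≤ 9 * δ := by
    have e : w - 1 = (v - N₀) * star N₀ := by rw [sub_mul, self_mul_star_of_norm_eq_one hN₀1, hw]
    rw [e, norm_mul, norm_star, hN₀1, mul_one]
    calc ‖v - N₀‖ ≤ ‖uN - N₀‖ + 2 * ‖κ₁ - 1‖ := by rw [hv]; exact norm_conj_sub_le hκ₁1 huN N₀
      _ ≤ 9 * δ := by linarith
  -- Step 2: the azimuth
  obtain ⟨κ₂, hκ₂1, hκ₂n, hwn0, hwre, hκ₂d⟩ := conj_azimuth_normalForm hC0 hC1 hw1 (by linarith)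
  obtain ⟨w', hw'⟩ : ∃ w' : ℍ, w' = κ₂ * w * κ₂ := ⟨_, rfl⟩
  have hw'1 : ‖w'‖ = 1 := by rw [hw', norm_mul, norm_mul, hκ₂1, hw1]; norm_num
  -- `N₀ κ₂* N₀* = κ₂`
  have hNκ : N₀ * star κ₂ * star N₀ = κ₂ := by
    rw [hN₀conj]
    have hdec := eq_re_add_inner_smul_of_commute hC0 hC1 hκ₂n
    have hstar : star κ₂ = (κ₂.re : ℍ) - ⟪κ₂, nC⟫ • nC := by
      conv_lhs => rw [hdec]
      rw [star_add, Quaternion.star_coe, Quaternion.star_smul, star_eq_neg_of_pure hC0, smul_neg, sub_eq_add_neg]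
    have hX : nN * nC * star nN = -nC := by
      rw [star_eq_neg_of_pure hN0, hNC, neg_mul, mul_neg, neg_neg, mul_assoc, hNN, mul_neg_one]
    rw [hstar, mul_sub, sub_mul, mul_smul_comm, smul_mul_assoc, hX, ← Quaternion.coe_commutes, mul_assoc, self_mul_star_of_norm_eq_one hN1,
      mul_one, smul_neg, sub_neg_eq_add]
    exact hdec.symm
  -- the logarithm of `w'`
  obtain ⟨b, hb⟩ : ∃ b : EuclideanSpace ℝ (Fin 3), b = logVec w' := ⟨_, rfl⟩
  have hwn0' : ⟪w', nC⟫ = 0 := by rw [hw']; exact hwn0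
  have hwre2 : w.re ≤ w'.re := by rw [hw']; exact hwre
  have hbC : ⟪b, ωC⟫ = 0 := by
    rw [hb]
    refine inner_logVec_eq_zero hwn0' fun him => ?_
    -- at a pole `w' = ±1`, and `Re w' ≥ Re w > 0`
    have hw're : w'.re ^ 2 = 1 := by
      have := norm_imVec_sq_of_norm_eq_one hw'1; rw [him, norm_zero] at this; linarith [this]
    have hsq : ‖w - 1‖ ^ 2 ≤ (9 / 40) ^ 2 := pow_le_pow_left₀ (norm_nonneg _) (hwd.trans (by linarith)) 2
    have hwre' : 31 / 32 ≤ w.re := by have := one_sub_re_eq hw1; linarith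
    have hpos : 0 < w'.re := by linarith
    have hfac : (w'.re - 1) * (w'.re + 1) = 0 := by nlinarith [hw're]
    rcases mul_eq_zero.mp hfac with h | h
    · linarith
    · linarith
  have hbn : ‖b‖ ≤ 15 * δ := by
    rw [hb, norm_logVec]
    calc Real.arccos w'.re ≤ Real.arccos w.re := Real.antitone_arccos hwre2
      _ ≤ Real.pi / 2 * ‖w - 1‖ := arccos_re_le_of_unit hw1
      _ ≤ Real.pi / 2 * (9 * δ) := mul_le_mul_of_nonneg_left hwd (by positivity)
      _ = (Real.pi / 2 * 9) * δ := by ring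
      _ ≤ 15 * δ := mul_le_mul_of_nonneg_right (by linarith [Real.pi_lt_d2]) hδ0
  refine ⟨κ₂ * κ₁, t, b, by rw [norm_mul, hκ₂1, hκ₁1, mul_one], ?_, htπ, by rw [hsin, abs_neg]; exact hre, hbC, hbn, ?_, ?_⟩
  · have e : κ₂ * κ₁ - 1 = κ₂ * (κ₁ - 1) + (κ₂ - 1) := by noncomm_ring
    rw [e]
    calc ‖κ₂ * (κ₁ - 1) + (κ₂ - 1)‖ ≤ ‖κ₂ * (κ₁ - 1)‖ + ‖κ₂ - 1‖ := norm_add_le _ _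
      _ = ‖κ₁ - 1‖ + ‖κ₂ - 1‖ := by rw [norm_mul, hκ₂1, one_mul]
      _ ≤ 40 * δ := by linarith
  · -- the seam anchor: `κ₂` commutes with the seam slice
    rw [star_mul, show κ₂ * κ₁ * uC * (star κ₁ * star κ₂) = κ₂ * (κ₁ * uC * star κ₁) * star κ₂ by noncomm_ring, hseam,
      exp_smul_mul_self hC]
    have hcomm : κ₂ * (((-Real.sin t : ℝ) : ℍ) + Real.cos t • nC) = (((-Real.sin t : ℝ) : ℍ) + Real.cos t • nC) * κ₂ := by
      rw [mul_add, add_mul, mul_smul_comm, smul_mul_assoc, hκ₂n, ← Quaternion.coe_commutes]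
    rw [hcomm, mul_assoc, self_mul_star_of_norm_eq_one hκ₂1, mul_one]
  · -- the link anchor
    rw [star_mul, show κ₂ * κ₁ * uN * (star κ₁ * star κ₂) = κ₂ * (κ₁ * uN * star κ₁) * star κ₂ by noncomm_ring]
    rw [← hv, ← hwv, hb, exp_imQuat_logVec hw'1, hw']
    calc κ₂ * (w * N₀) * star κ₂ = κ₂ * w * (N₀ * star κ₂ * star N₀) * N₀ := by
          rw [show κ₂ * w * (N₀ * star κ₂ * star N₀) * N₀ = κ₂ * w * N₀ * star κ₂ * (star N₀ * N₀) by noncomm_ring, hN₀N₀]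
          noncomm_ring
      _ = κ₂ * w * κ₂ * N₀ := by rw [hNκ]


/-- ★★ **THE TWO-ANCHOR COVERING THEOREM in `SU(2)`**, in the letters of ✓`VirialFluxGapAnchorChartDefs`: if the seam anchor `u_C` and the link
anchor `u_N` of a configuration are within `δ ≤ 1/40` (in `su2Quat` norm) of `C₀` (`su2Quat C₀ = ιω_C`) and `N₀` (`su2Quat N₀ = ±ιω_N`), there is a
constant `k ∈ SU(2)` with `‖su2Quat k − 1‖ ≤ 40δ` carrying them EXACTLY onto the anchor slice:
`k u_C k⁻¹ = seamSlice ω_C C₀ t`, `k u_N k⁻¹ = linkSlice ω_N ω_× N₀ b₁ b₂`, with `|t| < π/2`, `|sin t| ≤ δ`, `b₁² + b₂² ≤ (15δ)²`.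
(Every other coordinate `u` then lands at `k u k⁻¹`, within `‖su2Quat u − su2Quat q‖ + 80δ` of its base value `q`: `norm_conj_sub_le`.)
[cite: Bredon1972, Ch. II §§4–5] -/
theorem exists_conj_anchor_slice_su2 {ωC ωN ωX : EuclideanSpace ℝ (Fin 3)} (hC : ‖ωC‖ = 1) (hN : ‖ωN‖ = 1) (hCN : ⟪ωC, ωN⟫ = 0)
    (hX : imQuat ωX = imQuat ωC * imQuat ωN) {C₀ N₀ : SU2} (hC₀ : su2Quat C₀ = imQuat ωC)
    (hN₀ : su2Quat N₀ = imQuat ωN ∨ su2Quat N₀ = -imQuat ωN) {uC uN : SU2} {δ : ℝ} (hδ : δ ≤ 1 / 40)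
    (h1 : ‖su2Quat uC - su2Quat C₀‖ ≤ δ) (h2 : ‖su2Quat uN - su2Quat N₀‖ ≤ δ) :
    ∃ (k : SU2) (t b₁ b₂ : ℝ), ‖su2Quat k - 1‖ ≤ 40 * δ ∧ |t| < Real.pi / 2 ∧ |Real.sin t| ≤ δ ∧ b₁ ^ 2 + b₂ ^ 2 ≤ (15 * δ) ^ 2 ∧
      k * uC * k⁻¹ = seamSlice ωC C₀ t ∧ k * uN * k⁻¹ = linkSlice ωN ωX N₀ b₁ b₂ := by
  rw [hC₀] at h1
  obtain ⟨κ, t, b, hκ1, hκd, htπ, hsin, hbC, hbn, hseam, hlink⟩ :=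
    exists_conj_anchor_slice hC hN hCN hN₀ (norm_su2Quat uC) (norm_su2Quat uN) hδ h1 h2
  have hδ0 : 0 ≤ δ := (norm_nonneg _).trans h1
  -- the frame expansion of `b`
  have hbexp := eq_smul_add_smul_of_inner_eq_zero hC hN hCN hX hbC
  have hX1 : ‖ωX‖ = 1 := by
    rw [← norm_imQuat, hX, norm_mul, norm_imQuat, norm_imQuat, hC, hN, mul_one]
  have hNX : ⟪ωN, ωX⟫ = 0 := by
    rw [← inner_imQuat_imQuat, hX, real_inner_comm]; exact inner_pure_mul_right (imQuat_re ωC) (imQuat_re ωN)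
  have hbsq : ⟪b, ωN⟫ ^ 2 + ⟪b, ωX⟫ ^ 2 = ‖b‖ ^ 2 := by
    conv_rhs => rw [hbexp]
    rw [@norm_add_sq_real, norm_smul, norm_smul, hN, hX1, mul_one, mul_one, inner_smul_left, inner_smul_right, hNX,
      Real.norm_eq_abs, Real.norm_eq_abs, sq_abs, sq_abs]
    simp
  -- the group element
  set k : SU2 := quatToSU2 κ with hk
  have hkκ : su2Quat k = κ := by
    rw [hk, su2Quat_quatToSU2 (by intro h; rw [h, norm_zero] at hκ1; exact zero_ne_one hκ1), hκ1, inv_one, one_smul]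
  refine ⟨k, t, ⟪b, ωN⟫, ⟪b, ωX⟫, by rw [hkκ]; exact hκd, htπ, hsin, ?_, ?_, ?_⟩
  · rw [hbsq]; exact pow_le_pow_left₀ (norm_nonneg _) hbn 2
  · apply su2Quat_injective
    rw [su2Quat_mul, su2Quat_mul, su2Quat_inv, hkκ, hseam, seamSlice, su2Quat_mul, su2Quat_expPoint, hC₀]
  · apply su2Quat_injective
    rw [su2Quat_mul, su2Quat_mul, su2Quat_inv, hkκ, hlink, linkSlice, su2Quat_mul, su2Quat_expPoint, ← hbexp]

end Summit.QuantumFields.YangMills.Theorems.VirialFluxGap.AnchorSlice
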